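import Summits.KontsevichZagierPeriods.KontsevichZagierPeriods.Theorems.EllipticMomentKernel.Negative.GeneralCurve
import Literature.NumberTheory.Transcendental.KZLogCalculusProofs
import Literature.NumberTheory.Transcendental.KZSemialgebraicComplex

/-!
# Drefute candidates — line `merge-first-single-hermite` of crux `EllipticMomentKernel` (stmt-KontsevichZagierPeriods-10631)

Refuter seat `refuter-drefute-stmt-KontsevichZagierPeriods-10631-0` (mode drefute), positive by-products of the
stub attack: candidate proofs of stubs of `Lines/merge-first-single-hermite.lean`, signatures VERBATIM,
sorry-free, axioms {propext, Classical.choice, Quot.sound}. The lead may paste the bodies (namespace here is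
`…EllipticMomentKernel.Drefute`; the skeleton's is `…EllipticMomentKernel`).

* v1 (02:31Z): `stub_mergeToCarrier` (closure induction, rule 1b only; `hΔ` unused).
* v2 (02:45Z): `stub_numeratorValue` (linearity of the set integral; integrability helpers
  `integrableOn_aeval_oval`, `integrableOn_aeval_div_sqrt_oval` via a compact box ⊇ σ and
  `IntegrableOn.continuousOn_mul_of_subset` with `x^0/√f ∈ L¹(σ)` from `integrableOn_genIntegrandQ_oval`);
  `stub_sigmaRep` (the carrier representation `carrierRep h A B : IntegralRep 1`, semialgebraicity by
  `isSemialgebraicFunOn_aeval` + `mul_holds` + `add_holds`, reading `ℚ[X]` into `MvPolynomial (Fin 1) ℚ` by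
  `Polynomial.aeval_algHom_apply`).

* v3 (02:55Z): `stub_polynomialPart` (part 1: FTC on σ through `MeasurableEquiv.funUnique`, formal
  antiderivative `antideriv` on `ℚ[X]`, algebraicity by `isAlgebraic_aeval_sub_aeval`; part 2: ONE
  `KZ.newtonLeibnizRel` instance over `ℝ⁰` on `closedBandQ e₃ e₂` with primitive `G`, base `[pt, 0]`,
  then ONE domain-additivity move across the null `endsQ`). Uses the legality kit of
  `Negative/Targets.lean` (cdisprove, landed 02:37Z) — COPIED verbatim in `section Kit` below only because
  the farm had not yet built that module; a file that imports `…Negative.Targets` must delete `section Kit`.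

* v4 (03:00Z): `stub_hermiteExactForm` = the route's support ITEM `HermiteExactFormVanishes`
  (stmt-KontsevichZagierPeriods-3412) VERBATIM: the Hermite step is ONE `KZ.newtonLeibnizRel` instance over
  `ℝ⁰` on `closedBandQ e₃ e₂` with primitive `F = P√f` (semialgebraic by `mul_holds`/`sqrt_holds`,
  continuous on the closed fibre, `HasDerivAt` the unbounded integrand on the open fibre via
  `HasDerivAt.sqrt` + `hermite_alg`, `F(e₂) − F(e₃) = 0` at the roots), the integrand
  `hermiteIntegrand = N/√f` (`N = hermiteNumerator ∈ ℚ[X]`) being semialgebraic on the CLOSED band by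
  gluing its junk value `0` at the ends (`IsSemialgebraicFunOn.union`) and integrable there
  (`integrableOn_aeval_div_sqrt_oval` + null ends); then ONE domain-additivity move across `endsQ`.
  FIVE of the six stubs are now proved; only `stub_columnMove` (held by the lead) remains.

Attack verdicts so far (details in the seat's NOTES / final evidence note): all six stubs elaborate (skeleton rc0,
6 sorries); `simp_all` / `aesop` / `exact?` close none; no stub is vacuous (disc 4 0 = 64, honest generators
`genRepQ`, carriers `carrierRep`); `hΔ` is unnecessary in `stub_mergeToCarrier` (pure algebra) and only a
convenience elsewhere (empty-oval regime makes each stub trivially true); no counterexample found — the three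
proved stubs are true as typed, `stub_columnMove` / `stub_polynomialPart` / `stub_hermiteExactForm` audited on
paper move by move against `KZ.newtonLeibnizRel` (closed band vs open domain = null graphs/ends; primitives
`x^a y^{b+1}/(b+1)`, `G` with `G' = A`, `P√f`; all side conditions met).
-/

noncomputable section

open MeasureTheory Set
open scoped Polynomial

namespace Summit.KontsevichZagierPeriods.HermiteRigidity.EllipticMomentKernel.Drefute

open Literature.NumberTheory.Transcendental
open Literature.NumberTheory.Transcendental.KZ
open Summit.KontsevichZagierPeriods.HermiteRigidity.EllipticMomentKernelNegative
open Literature.ModelTheory.ExponentialFields (IsSemialgebraic isSemialgebraic_univ)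

variable {q₂ q₃ : ℚ}

/-- A compact box containing the oval: `σ = (e₃,e₂) ⊆ [e₃,e₂]`. [folklore] -/
theorem exists_isCompact_superset_oval (h : 0 < disc q₂ q₃) :
    ∃ K : Set (Fin 1 → ℝ), IsCompact K ∧ oval q₂ q₃ ⊆ K := by
  obtain ⟨e₃, e₂, e₁, h3, h2a, h2b, h1, hf⟩ := exists_roots h
  have h32 : e₃ < e₂ := by linarith
  have h21 : e₂ < e₁ := by linarith
  refine ⟨Set.Icc (fun _ => e₃) (fun _ => e₂), isCompact_Icc, fun p hp => ?_⟩
  rw [oval_eq_of_roots h32 h21 hf] at hp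
  refine ⟨fun i => ?_, fun i => ?_⟩
  · rw [Subsingleton.elim i 0]; exact hp.1.le
  · rw [Subsingleton.elim i 0]; exact hp.2.le

/-- Polynomials are integrable on the (bounded) oval. [folklore] -/
theorem integrableOn_aeval_oval (h : 0 < disc q₂ q₃) (A : ℚ[X]) :
    IntegrableOn (fun p : Fin 1 → ℝ => (Polynomial.aeval (p 0) A : ℝ)) (oval q₂ q₃) := by
  obtain ⟨K, hK, hsub⟩ := exists_isCompact_superset_oval h
  have hc : Continuous fun p : Fin 1 → ℝ => (Polynomial.aeval (p 0) A : ℝ) :=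
    (Polynomial.continuous_aeval A).comp (continuous_apply 0)
  exact (hc.continuousOn.integrableOn_compact hK).mono_set hsub

/-- `E(x)/√f(x)` is integrable on the oval for every `E ∈ ℚ[X]` (bounded times `1/√f ∈ L¹(σ)`).
[folklore] -/
theorem integrableOn_aeval_div_sqrt_oval (h : 0 < disc q₂ q₃) (E : ℚ[X]) :
    IntegrableOn (fun p : Fin 1 → ℝ => (Polynomial.aeval (p 0) E : ℝ) / Real.sqrt (cubic q₂ q₃ (p 0)))
      (oval q₂ q₃) := by
  obtain ⟨K, hK, hsub⟩ := exists_isCompact_superset_oval h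
  have hc : Continuous fun p : Fin 1 → ℝ => (Polynomial.aeval (p 0) E : ℝ) :=
    (Polynomial.continuous_aeval E).comp (continuous_apply 0)
  have h0 : IntegrableOn (fun p : Fin 1 → ℝ => 1 / Real.sqrt (cubic q₂ q₃ (p 0))) (oval q₂ q₃) := by
    simpa using integrableOn_genIntegrandQ_oval h 0
  have hmeas : MeasurableSet (oval q₂ q₃) := (isSemialgebraic_oval h).measurableSet_holds
  have hmul := h0.continuousOn_mul_of_subset hc.continuousOn hK hmeas hsub
  refine hmul.congr_fun (fun p _ => ?_) hmeas
  simp only [mul_one_div]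

/-- `stub_numeratorValue`, verbatim signature, sorry-free. -/
theorem stub_numeratorValue (q₂ q₃ : ℚ) (hΔ : 0 < disc q₂ q₃) (A E : ℚ[X]) (α β : ℚ)
    (hE : (∫ p in oval q₂ q₃, (Polynomial.aeval (p 0) E : ℝ) / Real.sqrt (cubic q₂ q₃ (p 0))) = 0)
    (s : IntegralRep 1) (hs : s.domain = oval q₂ q₃)
    (hsi : EqOn s.integrand (fun p => (Polynomial.aeval (p 0) A : ℝ) +
      (Polynomial.aeval (p 0) (Polynomial.C α + Polynomial.C β * Polynomial.X + E) : ℝ) /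
        Real.sqrt (cubic q₂ q₃ (p 0))) (oval q₂ q₃)) :
    s.value = (∫ p in oval q₂ q₃, (Polynomial.aeval (p 0) A : ℝ)) +
      (α : ℝ) * J0 q₂ q₃ + (β : ℝ) * J1 q₂ q₃ := by
  have hmeas : MeasurableSet (oval q₂ q₃) := hs ▸ IntegralRep.measurableSet_domain_holds s
  have hA := integrableOn_aeval_oval hΔ A
  have h0 : IntegrableOn (fun p : Fin 1 → ℝ => 1 / Real.sqrt (cubic q₂ q₃ (p 0))) (oval q₂ q₃) := by
    simpa using integrableOn_genIntegrandQ_oval hΔ 0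
  have h1 : IntegrableOn (fun p : Fin 1 → ℝ => p 0 / Real.sqrt (cubic q₂ q₃ (p 0))) (oval q₂ q₃) := by
    simpa using integrableOn_genIntegrandQ_oval hΔ 1
  have hEi := integrableOn_aeval_div_sqrt_oval hΔ E
  have hα : IntegrableOn (fun p : Fin 1 → ℝ => (α : ℝ) * (1 / Real.sqrt (cubic q₂ q₃ (p 0))))
      (oval q₂ q₃) := Integrable.const_mul h0 _
  have hβ : IntegrableOn (fun p : Fin 1 → ℝ => (β : ℝ) * (p 0 / Real.sqrt (cubic q₂ q₃ (p 0))))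
      (oval q₂ q₃) := Integrable.const_mul h1 _
  have hAα : IntegrableOn (fun p : Fin 1 → ℝ => (Polynomial.aeval (p 0) A : ℝ) +
      (α : ℝ) * (1 / Real.sqrt (cubic q₂ q₃ (p 0)))) (oval q₂ q₃) := hA.add hα
  have hAαβ : IntegrableOn (fun p : Fin 1 → ℝ => (Polynomial.aeval (p 0) A : ℝ) +
      (α : ℝ) * (1 / Real.sqrt (cubic q₂ q₃ (p 0))) +
      (β : ℝ) * (p 0 / Real.sqrt (cubic q₂ q₃ (p 0)))) (oval q₂ q₃) := hAα.add hβ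
  calc s.value = ∫ p in oval q₂ q₃, s.integrand p := by rw [IntegralRep.value, hs]
    _ = ∫ p in oval q₂ q₃, ((Polynomial.aeval (p 0) A : ℝ) +
          (α : ℝ) * (1 / Real.sqrt (cubic q₂ q₃ (p 0))) +
          (β : ℝ) * (p 0 / Real.sqrt (cubic q₂ q₃ (p 0))) +
          (Polynomial.aeval (p 0) E : ℝ) / Real.sqrt (cubic q₂ q₃ (p 0))) := by
        refine setIntegral_congr_fun hmeas fun p hp => ?_
        rw [hsi hp]
        simp only [map_add, map_mul, Polynomial.aeval_C, Polynomial.aeval_X, eq_ratCast]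
        ring
    _ = (∫ p in oval q₂ q₃, ((Polynomial.aeval (p 0) A : ℝ) +
          (α : ℝ) * (1 / Real.sqrt (cubic q₂ q₃ (p 0))) +
          (β : ℝ) * (p 0 / Real.sqrt (cubic q₂ q₃ (p 0))))) +
          (∫ p in oval q₂ q₃, (Polynomial.aeval (p 0) E : ℝ) / Real.sqrt (cubic q₂ q₃ (p 0))) :=
        integral_add hAαβ hEi
    _ = (∫ p in oval q₂ q₃, ((Polynomial.aeval (p 0) A : ℝ) +
          (α : ℝ) * (1 / Real.sqrt (cubic q₂ q₃ (p 0))))) +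
          (∫ p in oval q₂ q₃, (β : ℝ) * (p 0 / Real.sqrt (cubic q₂ q₃ (p 0)))) +
          (∫ p in oval q₂ q₃, (Polynomial.aeval (p 0) E : ℝ) / Real.sqrt (cubic q₂ q₃ (p 0))) := by
        congr 1
        exact integral_add hAα hβ
    _ = (∫ p in oval q₂ q₃, (Polynomial.aeval (p 0) A : ℝ)) +
          (∫ p in oval q₂ q₃, (α : ℝ) * (1 / Real.sqrt (cubic q₂ q₃ (p 0)))) +
          (∫ p in oval q₂ q₃, (β : ℝ) * (p 0 / Real.sqrt (cubic q₂ q₃ (p 0)))) +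
          (∫ p in oval q₂ q₃, (Polynomial.aeval (p 0) E : ℝ) / Real.sqrt (cubic q₂ q₃ (p 0))) := by
        congr 2
        exact integral_add hA hα
    _ = (∫ p in oval q₂ q₃, (Polynomial.aeval (p 0) A : ℝ)) +
          (α : ℝ) * J0 q₂ q₃ + (β : ℝ) * J1 q₂ q₃ := by
        rw [integral_const_mul, integral_const_mul, hE, add_zero]
        rfl

/-- The carrier integrand `A(x) + B(x)/√f(x)` is `ℚ`-semialgebraic on the oval. [folklore] -/
theorem isSemialgebraicFunOn_carrier (h : 0 < disc q₂ q₃) (A B : ℚ[X]) :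
    IsSemialgebraicFunOn ℚ (oval q₂ q₃) (fun p : Fin 1 → ℝ => (Polynomial.aeval (p 0) A : ℝ) +
      (Polynomial.aeval (p 0) B : ℝ) / Real.sqrt (cubic q₂ q₃ (p 0))) := by
  have hs := isSemialgebraic_oval h
  -- a one-variable polynomial read as an `MvPolynomial (Fin 1) ℚ`
  have hpoly : ∀ (P : ℚ[X]), IsSemialgebraicFunOn ℚ (oval q₂ q₃)
      (fun p : Fin 1 → ℝ => (Polynomial.aeval (p 0) P : ℝ)) := by
    intro P
    refine (isSemialgebraicFunOn_aeval hs
      (Polynomial.aeval (MvPolynomial.X 0 : MvPolynomial (Fin 1) ℚ) P)).congr fun p _ => ?_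
    dsimp only
    rw [← Polynomial.aeval_algHom_apply (MvPolynomial.aeval p) (MvPolynomial.X 0) P,
      MvPolynomial.aeval_X]
  have h0 := isSemialgebraicFunOn_genIntegrandQ h 0
  have hmul := IsSemialgebraicFunOn.mul_holds (hpoly B) h0
  have hadd := IsSemialgebraicFunOn.add_holds (hpoly A) hmul
  refine hadd.congr fun p _ => ?_
  simp only [Pi.add_apply, Pi.mul_apply, pow_zero, mul_one_div]

/-- The carrier integrand is integrable on the oval. [folklore] -/
theorem integrableOn_carrier (h : 0 < disc q₂ q₃) (A B : ℚ[X]) :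
    IntegrableOn (fun p : Fin 1 → ℝ => (Polynomial.aeval (p 0) A : ℝ) +
      (Polynomial.aeval (p 0) B : ℝ) / Real.sqrt (cubic q₂ q₃ (p 0))) (oval q₂ q₃) :=
  (integrableOn_aeval_oval h A).add (integrableOn_aeval_div_sqrt_oval h B)

/-- The carrier representation `[σ, A + B/√f]`. [cite: KontsevichZagier2001, §1.1] -/
def carrierRep (h : 0 < disc q₂ q₃) (A B : ℚ[X]) : IntegralRep 1 where
  domain := oval q₂ q₃
  integrand := fun p => (Polynomial.aeval (p 0) A : ℝ) +
    (Polynomial.aeval (p 0) B : ℝ) / Real.sqrt (cubic q₂ q₃ (p 0))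
  isSemialgebraic_domain := isSemialgebraic_oval h
  isSemialgebraicFunOn_integrand := isSemialgebraicFunOn_carrier h A B
  integrableOn := integrableOn_carrier h A B

/-- `stub_sigmaRep`, verbatim signature, sorry-free. -/
theorem stub_sigmaRep (q₂ q₃ : ℚ) (hΔ : 0 < disc q₂ q₃) (A B : ℚ[X]) :
    ∃ s : IntegralRep 1, s.domain = oval q₂ q₃ ∧
      s.integrand = fun p => (Polynomial.aeval (p 0) A : ℝ) +
        (Polynomial.aeval (p 0) B : ℝ) / Real.sqrt (cubic q₂ q₃ (p 0)) :=
  ⟨carrierRep hΔ A B, rfl, rfl⟩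

/-- `stub_mergeToCarrier`, verbatim signature, sorry-free. -/
theorem stub_mergeToCarrier (q₂ q₃ : ℚ) (_hΔ : 0 < disc q₂ q₃)
    (hrep : ∀ A B : ℚ[X], ∃ s : IntegralRep 1, s.domain = oval q₂ q₃ ∧
      s.integrand = fun p => (Polynomial.aeval (p 0) A : ℝ) +
        (Polynomial.aeval (p 0) B : ℝ) / Real.sqrt (cubic q₂ q₃ (p 0)))
    (hgen₂ : ∀ x ∈ gens₂ q₂ q₃, ∃ (A B : ℚ[X]) (s : IntegralRep 1), s.domain = oval q₂ q₃ ∧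
      EqOn s.integrand (fun p => (Polynomial.aeval (p 0) A : ℝ) +
        (Polynomial.aeval (p 0) B : ℝ) / Real.sqrt (cubic q₂ q₃ (p 0))) (oval q₂ q₃) ∧
      x - KZ.of s ∈ KZ.relations) :
    ∀ c ∈ AddSubgroup.closure (gens q₂ q₃), ∃ (A B : ℚ[X]) (s : IntegralRep 1),
      s.domain = oval q₂ q₃ ∧
      EqOn s.integrand (fun p => (Polynomial.aeval (p 0) A : ℝ) +
        (Polynomial.aeval (p 0) B : ℝ) / Real.sqrt (cubic q₂ q₃ (p 0))) (oval q₂ q₃) ∧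
      c - KZ.of s ∈ KZ.relations := by
  intro c hc
  induction hc using AddSubgroup.closure_induction with
  | mem x hx =>
    rcases hx with hx | hx
    · exact hgen₂ x hx
    · obtain ⟨r, m, hr, hri, rfl⟩ := hx
      refine ⟨0, Polynomial.X ^ m, r, hr, fun p hp => ?_, ?_⟩
      · rw [hri hp]
        simp
      · rw [sub_self]
        exact relations.zero_mem
  | zero =>
    obtain ⟨z, hz, hzi⟩ := hrep 0 0
    refine ⟨0, 0, z, hz, fun p _ => by rw [hzi], ?_⟩
    rw [zero_sub]
    refine relations.neg_mem (of_mem_relations_of_eqOn_zero z fun p _ => ?_)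
    rw [hzi]
    simp
  | add x y _ _ hx hy =>
    obtain ⟨A₁, B₁, s₁, hs₁, hs₁i, hxs⟩ := hx
    obtain ⟨A₂, B₂, s₂, hs₂, hs₂i, hys⟩ := hy
    obtain ⟨s, hs, hsi⟩ := hrep (A₁ + A₂) (B₁ + B₂)
    refine ⟨A₁ + A₂, B₁ + B₂, s, hs, fun p _ => by rw [hsi], ?_⟩
    have h1b : KZ.of s - KZ.of s₁ - KZ.of s₂ ∈ KZ.relations := by
      refine integrandAddRel_subset_relations ⟨1, s, s₁, s₂, hs₁.trans hs.symm,
        hs₂.trans hs.symm, fun p hp => ?_, rfl⟩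
      rw [hs] at hp
      rw [Pi.add_apply, hsi, hs₁i hp, hs₂i hp]
      simp only [map_add]
      ring
    have : x + y - KZ.of s = (x - KZ.of s₁) + (y - KZ.of s₂) - (KZ.of s - KZ.of s₁ - KZ.of s₂) := by
      abel
    rw [this]
    exact relations.sub_mem (relations.add_mem hxs hys) h1b
  | neg x _ hx =>
    obtain ⟨A, B, s, hs, hsi, hxs⟩ := hx
    obtain ⟨t, ht, hti⟩ := hrep (-A) (-B)
    refine ⟨-A, -B, t, ht, fun p _ => by rw [hti], ?_⟩
    have hst : KZ.of s + KZ.of t ∈ KZ.relations := by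
      refine of_add_of_mem_relations_of_eqOn_neg (ht.trans hs.symm) fun p hp => ?_
      rw [hs] at hp
      rw [hti, Pi.neg_apply, hsi hp]
      simp only [map_neg]
      ring
    have : -x - KZ.of t = -(x - KZ.of s) - (KZ.of s + KZ.of t) := by abel
    rw [this]
    exact relations.sub_mem (relations.neg_mem hxs) hst

/-! # v3: `stub_polynomialPart` -/


/-! ## Legality kit (VERBATIM copy of `Negative/Targets.lean` §7, cdisprove seat p-landed 02:37Z; copied
only because the farm had not yet built that module when this candidate was checked — the import
version `CandidatePolyPart.lean` is identical with these declarations deleted) -/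

section Kit

open Literature.ModelTheory.ExponentialFields (IsSemialgebraic isSemialgebraic_setOf_eval_pos
  isSemialgebraic_setOf_eval_eq_zero isSemialgebraic_univ)
open MvPolynomial (aeval X C)

/-- Roots of the cubic are real algebraic numbers (the cubic is a non-zero `ℚ`-polynomial).
[folklore] -/
theorem isAlgebraic_of_cubic_eq_zero {e : ℝ} (he : cubic q₂ q₃ e = 0) : IsAlgebraic ℚ e := by
  refine ⟨4 * Polynomial.X ^ 3 - Polynomial.C q₂ * Polynomial.X - Polynomial.C q₃, ?_, ?_⟩
  · intro h0
    have h3 := congrArg (fun p : Polynomial ℚ => p.coeff 3) h0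
    simp only [Polynomial.coeff_sub, Polynomial.coeff_C_mul,
      Polynomial.coeff_X, Polynomial.coeff_C, Polynomial.coeff_zero] at h3
    norm_num at h3
  · unfold cubic at he
    simp only [map_sub, map_mul, map_pow, Polynomial.aeval_X, Polynomial.aeval_C, eq_ratCast]
    have h4 : (Polynomial.aeval e) (4 : Polynomial ℚ) = (4 : ℝ) := map_ofNat _ 4
    rw [h4]
    linarith

/-- Polynomial expressions in an algebraic number are algebraic. [folklore] -/
theorem isAlgebraic_aeval_of_isAlgebraic {e : ℝ} (he : IsAlgebraic ℚ e) (R : Polynomial ℚ) :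
    IsAlgebraic ℚ (Polynomial.aeval e R) := by
  rw [isAlgebraic_iff_isIntegral] at he ⊢
  induction R using Polynomial.induction_on' with
  | add p q hp hq => simpa [map_add] using hp.add hq
  | monomial n a =>
    rw [← Polynomial.C_mul_X_pow_eq_monomial, map_mul, map_pow, Polynomial.aeval_C,
      Polynomial.aeval_X]
    exact isIntegral_algebraMap.mul (he.pow n)

/-- The constant produced by the `b`-odd branch / `stub_polynomialToConstant`,
`R(e₂) − R(e₃)` with `R ∈ ℚ[X]`, is real algebraic (so `[pt, R(e₂) − R(e₃)]` is a legal
`IntegralRep 0` by `isSemialgebraicFunOn_const_of_isAlgebraic`). [folklore] -/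
theorem isAlgebraic_aeval_sub_aeval {e₃ e₂ : ℝ} (h₃ : cubic q₂ q₃ e₃ = 0) (h₂ : cubic q₂ q₃ e₂ = 0)
    (R : Polynomial ℚ) : IsAlgebraic ℚ (Polynomial.aeval e₂ R - Polynomial.aeval e₃ R) := by
  have h := (isAlgebraic_aeval_of_isAlgebraic (isAlgebraic_of_cubic_eq_zero h₂) R)
  have h' := (isAlgebraic_aeval_of_isAlgebraic (isAlgebraic_of_cubic_eq_zero h₃) R)
  rw [isAlgebraic_iff_isIntegral] at h h' ⊢
  exact h.sub h'

/-- The three roots are the only zeros of the factored cubic. [folklore] -/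
theorem eq_roots_of_cubic_eq_zero {e₃ e₂ e₁ y : ℝ}
    (hf : ∀ x, cubic q₂ q₃ x = 4 * (x - e₃) * (x - e₂) * (x - e₁)) (hy : cubic q₂ q₃ y = 0) :
    y = e₃ ∨ y = e₂ ∨ y = e₁ := by
  rw [hf] at hy
  rcases mul_eq_zero.1 hy with h | h
  · rcases mul_eq_zero.1 h with h | h
    · rcases mul_eq_zero.1 h with h | h
      · norm_num at h
      · exact Or.inl (by linarith)
    · exact Or.inr (Or.inl (by linarith))
  · exact Or.inr (Or.inr (by linarith))

/-- The roots of the factored cubic are roots. [folklore] -/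
theorem cubic_roots_eq_zero {e₃ e₂ e₁ : ℝ}
    (hf : ∀ x, cubic q₂ q₃ x = 4 * (x - e₃) * (x - e₂) * (x - e₁)) :
    cubic q₂ q₃ e₃ = 0 ∧ cubic q₂ q₃ e₂ = 0 ∧ cubic q₂ q₃ e₁ = 0 := by
  refine ⟨?_, ?_, ?_⟩ <;> rw [hf] <;> ring

/-- The two branch points `{e₃, e₂} ⊆ ℝ¹` bounding the oval. [folklore] -/
def endsQ (e₃ e₂ : ℝ) : Set (Fin 1 → ℝ) := {z | z 0 = e₃ ∨ z 0 = e₂}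

/-- The CLOSED band `[e₃, e₂] ⊆ ℝ¹` in the literal shape of `KZ.newtonLeibnizRel` over the base
`univ ⊆ ℝ⁰` with the constant (real algebraic, in general irrational) bounds `a = e₃`, `b = e₂` —
the band of the Hermite move (`stub_hermiteReduction`) and of `stub_polynomialToConstant`.
[folklore] -/
def closedBandQ (e₃ e₂ : ℝ) : Set (Fin 1 → ℝ) :=
  {z | (Fin.init z : Fin 0 → ℝ) ∈ (univ : Set (Fin 0 → ℝ)) ∧
    (fun _ => e₃) (Fin.init z) ≤ z (Fin.last 0) ∧ z (Fin.last 0) ≤ (fun _ => e₂) (Fin.init z)}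

/-- `closedBandQ e₃ e₂ = [e₃, e₂]`. [folklore] -/
theorem closedBandQ_eq (e₃ e₂ : ℝ) : closedBandQ e₃ e₂ = {z : Fin 1 → ℝ | e₃ ≤ z 0 ∧ z 0 ≤ e₂} := by
  ext z; simp [closedBandQ]

/-- `[e₃, e₂] = σ ∪ {e₃, e₂}` for the factored cubic. [folklore] -/
theorem closedBandQ_eq_union {e₃ e₂ e₁ : ℝ} (h32 : e₃ < e₂) (h21 : e₂ < e₁)
    (hf : ∀ x, cubic q₂ q₃ x = 4 * (x - e₃) * (x - e₂) * (x - e₁)) :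
    closedBandQ e₃ e₂ = oval q₂ q₃ ∪ endsQ e₃ e₂ := by
  rw [closedBandQ_eq, oval_eq_of_roots h32 h21 hf]
  ext z
  simp only [mem_setOf_eq, mem_union, endsQ, mem_Ioo]
  constructor
  · rintro ⟨h1, h2⟩
    rcases h1.lt_or_eq with h1 | h1
    · rcases h2.lt_or_eq with h2 | h2
      · exact Or.inl ⟨h1, h2⟩
      · exact Or.inr (Or.inr h2)
    · exact Or.inr (Or.inl h1.symm)
  · rintro (⟨h1, h2⟩ | h | h)
    · exact ⟨h1.le, h2.le⟩
    · rw [h]; exact ⟨le_rfl, h32.le⟩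
    · rw [h]; exact ⟨h32.le, le_rfl⟩

/-- `σ` and the branch points are disjoint. [folklore] -/
theorem oval_inter_endsQ {e₃ e₂ e₁ : ℝ} (h32 : e₃ < e₂) (h21 : e₂ < e₁)
    (hf : ∀ x, cubic q₂ q₃ x = 4 * (x - e₃) * (x - e₂) * (x - e₁)) :
    oval q₂ q₃ ∩ endsQ e₃ e₂ = ∅ := by
  rw [oval_eq_of_roots h32 h21 hf]
  ext z
  simp only [mem_inter_iff, mem_setOf_eq, mem_Ioo, endsQ, mem_empty_iff_false, iff_false]
  rintro ⟨⟨h1, h2⟩, h | h⟩ <;> rw [h] at h1 h2 <;> linarith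

/-- **The branch points are `ℚ`-semialgebraic for EVERY admissible parameter** — no
Tarski–Seidenberg and no explicit isolating formula needed: `e₃, e₂` are real algebraic
(`isAlgebraic_of_cubic_eq_zero`) and coordinate hyperplanes at real algebraic heights are
`ℚ`-definable (tree: `isSemialgebraic_setOf_apply_eq_of_isAlgebraic`). [folklore] -/
theorem isSemialgebraic_endsQ {e₃ e₂ : ℝ} (h₃ : cubic q₂ q₃ e₃ = 0) (h₂ : cubic q₂ q₃ e₂ = 0) :
    IsSemialgebraic ℚ (endsQ e₃ e₂) :=
  (isSemialgebraic_setOf_apply_eq_of_isAlgebraic (isAlgebraic_of_cubic_eq_zero h₃) (0 : Fin 1)).union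
    (isSemialgebraic_setOf_apply_eq_of_isAlgebraic (isAlgebraic_of_cubic_eq_zero h₂) (0 : Fin 1))

/-- The branch points form a two-point, hence Lebesgue-null, subset of `ℝ¹`. [folklore] -/
theorem volume_endsQ (e₃ e₂ : ℝ) : volume (endsQ e₃ e₂) = 0 := by
  have : endsQ e₃ e₂ = {fun _ => e₃, fun _ => e₂} := by
    ext z; simp [endsQ, funext_iff, Fin.forall_fin_one]
  rw [this]
  exact (Set.toFinite _).measure_zero _

/-- **The closed Hermite band `[e₃, e₂]` is `ℚ`-semialgebraic for every admissible parameter.**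
[folklore] -/
theorem isSemialgebraic_closedBandQ {e₃ e₂ e₁ : ℝ} (h32 : e₃ < e₂) (h21 : e₂ < e₁)
    (hf : ∀ x, cubic q₂ q₃ x = 4 * (x - e₃) * (x - e₂) * (x - e₁)) :
    IsSemialgebraic ℚ (closedBandQ e₃ e₂) := by
  obtain ⟨h₃, h₂, -⟩ := cubic_roots_eq_zero hf
  obtain ⟨hpos, -⟩ := cubic_sign_of_roots h32 h21 hf
  have hd : 0 < disc q₂ q₃ :=
    disc_pos_of_sign_change (x := (e₃ + e₂) / 2) (t := (e₂ + e₁) / 2) (by linarith)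
      (hpos _ ⟨by linarith, by linarith⟩)
      ((cubic_sign_of_roots h32 h21 hf).2 _ ⟨by linarith, by linarith⟩)
  rw [closedBandQ_eq_union h32 h21 hf]
  exact (isSemialgebraic_oval hd).union (isSemialgebraic_endsQ h₃ h₂)

/-- The bounds of the Hermite band are legal: the constant functions `e₃`, `e₂` on the base
`univ ⊆ ℝ⁰` are `ℚ`-semialgebraic (tree: `isSemialgebraicFunOn_const_of_isAlgebraic`). [folklore] -/
theorem isSemialgebraicFunOn_const_root {e : ℝ} (he : cubic q₂ q₃ e = 0) :
    IsSemialgebraicFunOn ℚ (univ : Set (Fin 0 → ℝ)) (fun _ => e) :=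
  isSemialgebraicFunOn_const_of_isAlgebraic isSemialgebraic_univ (isAlgebraic_of_cubic_eq_zero he)

end Kit


/-! ## A formal antiderivative on `ℚ[X]` -/

/-- `antideriv A = Σ aₙ X^{n+1}/(n+1)`. [folklore] -/
def antideriv (A : ℚ[X]) : ℚ[X] :=
  A.sum fun n a => Polynomial.C (a / ((n : ℚ) + 1)) * Polynomial.X ^ (n + 1)

/-- `(antideriv A)′ = A`. [folklore] -/
theorem derivative_antideriv (A : ℚ[X]) : Polynomial.derivative (antideriv A) = A := by
  conv_rhs => rw [A.as_sum_support_C_mul_X_pow]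
  rw [antideriv, Polynomial.sum_def, map_sum]
  refine Finset.sum_congr rfl fun n _ => ?_
  rw [Polynomial.derivative_C_mul_X_pow]
  have hn : ((n : ℚ) + 1) ≠ 0 := by positivity
  congr 2
  push_cast
  field_simp

/-- `x ↦ G(x)` has derivative `A(x)` (real points). [folklore] -/
theorem hasDerivAt_aeval_antideriv (A : ℚ[X]) (x : ℝ) :
    HasDerivAt (fun t : ℝ => (Polynomial.aeval t (antideriv A) : ℝ)) (Polynomial.aeval x A) x := by
  simpa [derivative_antideriv] using (antideriv A).hasDerivAt_aeval x

/-! ## Part 1: `∫_σ A = G(e₂) − G(e₃)` is real algebraic -/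

/-- FTC on the oval: `∫_σ A = G(e₂) − G(e₃)`. [folklore] -/
theorem integral_aeval_oval {e₃ e₂ e₁ : ℝ} (h32 : e₃ < e₂) (h21 : e₂ < e₁)
    (hf : ∀ x, cubic q₂ q₃ x = 4 * (x - e₃) * (x - e₂) * (x - e₁)) (A : ℚ[X]) :
    (∫ p in oval q₂ q₃, (Polynomial.aeval (p 0) A : ℝ)) =
      Polynomial.aeval e₂ (antideriv A) - Polynomial.aeval e₃ (antideriv A) := by
  have hset : oval q₂ q₃ = e1 ⁻¹' Ioo e₃ e₂ := by
    rw [oval_eq_of_roots h32 h21 hf]; ext p; simp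
  have key := measurePreserving_e1.setIntegral_preimage_emb e1.measurableEmbedding
    (fun x : ℝ => (Polynomial.aeval x A : ℝ)) (Ioo e₃ e₂)
  simp only [e1_apply] at key
  rw [hset, key, ← integral_Ioc_eq_integral_Ioo, ← intervalIntegral.integral_of_le h32.le]
  exact intervalIntegral.integral_eq_sub_of_hasDerivAt
    (fun x _ => hasDerivAt_aeval_antideriv A x)
    ((Polynomial.continuous_aeval A).intervalIntegrable _ _)

/-- **Part 1 of the stub**: `∫_σ A` is a real algebraic number. [folklore] -/
theorem isAlgebraic_integral_aeval_oval (h : 0 < disc q₂ q₃) (A : ℚ[X]) :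
    IsAlgebraic ℚ (∫ p in oval q₂ q₃, (Polynomial.aeval (p 0) A : ℝ)) := by
  obtain ⟨e₃, e₂, e₁, h3, h2a, h2b, h1, hf⟩ := exists_roots h
  have h32 : e₃ < e₂ := by linarith
  have h21 : e₂ < e₁ := by linarith
  obtain ⟨he₃, he₂, -⟩ := cubic_roots_eq_zero hf
  rw [integral_aeval_oval h32 h21 hf A]
  exact isAlgebraic_aeval_sub_aeval he₃ he₂ (antideriv A)

/-! ## Part 2: `[σ, A] ∈ relations` when `∫_σ A = 0` — one Newton–Leibniz move over `ℝ⁰` -/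

section PartTwo

variable {e₃ e₂ e₁ : ℝ}

/-- A one-variable `ℚ`-polynomial is a `ℚ`-semialgebraic function on any `ℚ`-semialgebraic
`s ⊆ ℝ¹`. [folklore] -/
theorem isSemialgebraicFunOn_aeval_apply_zero {s : Set (Fin 1 → ℝ)} (hs : IsSemialgebraic ℚ s)
    (P : ℚ[X]) : IsSemialgebraicFunOn ℚ s (fun p : Fin 1 → ℝ => (Polynomial.aeval (p 0) P : ℝ)) := by
  refine (isSemialgebraicFunOn_aeval hs
    (Polynomial.aeval (MvPolynomial.X 0 : MvPolynomial (Fin 1) ℚ) P)).congr fun p _ => ?_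
  dsimp only
  rw [← Polynomial.aeval_algHom_apply (MvPolynomial.aeval p) (MvPolynomial.X 0) P,
    MvPolynomial.aeval_X]

/-- The closed band is compact (`= e1 ⁻¹' [e₃, e₂]`, a box). [folklore] -/
theorem closedBandQ_subset_Icc (e₃ e₂ : ℝ) :
    closedBandQ e₃ e₂ ⊆ Set.Icc (fun _ : Fin 1 => e₃) (fun _ => e₂) := by
  intro z hz
  rw [closedBandQ_eq] at hz
  refine ⟨fun i => ?_, fun i => ?_⟩
  · rw [Subsingleton.elim i 0]; exact hz.1
  · rw [Subsingleton.elim i 0]; exact hz.2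

/-- The band representation `[[e₃,e₂], A]` (the `r` of the Newton–Leibniz move). [folklore] -/
def polyBandRep (h32 : e₃ < e₂) (h21 : e₂ < e₁)
    (hf : ∀ x, cubic q₂ q₃ x = 4 * (x - e₃) * (x - e₂) * (x - e₁)) (A : ℚ[X]) : IntegralRep 1 where
  domain := closedBandQ e₃ e₂
  integrand := fun p => (Polynomial.aeval (p 0) A : ℝ)
  isSemialgebraic_domain := isSemialgebraic_closedBandQ h32 h21 hf
  isSemialgebraicFunOn_integrand :=
    isSemialgebraicFunOn_aeval_apply_zero (isSemialgebraic_closedBandQ h32 h21 hf) A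
  integrableOn :=
    ((((Polynomial.continuous_aeval A).comp (continuous_apply 0)).continuousOn.integrableOn_compact
      isCompact_Icc).mono_set (closedBandQ_subset_Icc e₃ e₂))

/-- The null representation on the two ends `{e₃, e₂}` with integrand `A`. [folklore] -/
def polyEndsRep (hf : ∀ x, cubic q₂ q₃ x = 4 * (x - e₃) * (x - e₂) * (x - e₁)) (A : ℚ[X]) :
    IntegralRep 1 where
  domain := endsQ e₃ e₂
  integrand := fun p => (Polynomial.aeval (p 0) A : ℝ)
  isSemialgebraic_domain :=
    isSemialgebraic_endsQ (cubic_roots_eq_zero hf).1 (cubic_roots_eq_zero hf).2.1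
  isSemialgebraicFunOn_integrand :=
    isSemialgebraicFunOn_aeval_apply_zero
      (isSemialgebraic_endsQ (cubic_roots_eq_zero hf).1 (cubic_roots_eq_zero hf).2.1) A
  integrableOn := by
    rw [IntegrableOn, Measure.restrict_eq_zero.2 (volume_endsQ e₃ e₂)]
    exact integrable_zero_measure

/-- The base of the move: the point `ℝ⁰` with integrand `0`. [folklore] -/
def zeroBaseRep : IntegralRep 0 where
  domain := univ
  integrand := fun _ => 0
  isSemialgebraic_domain := isSemialgebraic_univ
  isSemialgebraicFunOn_integrand :=
    (isSemialgebraicFunOn_aeval isSemialgebraic_univ (0 : MvPolynomial (Fin 0) ℚ)).congr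
      fun _ _ => by simp
  integrableOn := integrableOn_zero

/-- `[pt, 0] ∈ relations`. [folklore] -/
theorem of_zeroBaseRep_mem_relations : KZ.of zeroBaseRep ∈ relations :=
  of_mem_relations_of_eqOn_zero zeroBaseRep fun _ _ => rfl

/-- `Fin.snoc` into `ℝ¹` from `ℝ⁰`. [folklore] -/
theorem snoc_apply_zero' (x : Fin 0 → ℝ) (t : ℝ) : (Fin.snoc x t : Fin 1 → ℝ) 0 = t := rfl

/-- **The polynomial part is ONE legal Newton–Leibniz move** when `G(e₂) − G(e₃) = 0`:
`[polyBandRep] − [zeroBaseRep] ∈ KZ.newtonLeibnizRel` (base `ℝ⁰`, bounds `a = e₃`, `b = e₂`,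
primitive `G`). [cite: KontsevichZagier2001, §1.2 rule (3)] -/
theorem of_polyBandRep_sub_mem_newtonLeibnizRel (h32 : e₃ < e₂) (h21 : e₂ < e₁)
    (hf : ∀ x, cubic q₂ q₃ x = 4 * (x - e₃) * (x - e₂) * (x - e₁)) (A : ℚ[X])
    (hG : (Polynomial.aeval e₂ (antideriv A) : ℝ) - Polynomial.aeval e₃ (antideriv A) = 0) :
    KZ.of (polyBandRep h32 h21 hf A) - KZ.of zeroBaseRep ∈ newtonLeibnizRel := by
  obtain ⟨he₃, he₂, -⟩ := cubic_roots_eq_zero hf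
  refine ⟨0, polyBandRep h32 h21 hf A, zeroBaseRep, fun _ => e₃, fun _ => e₂,
    fun z => (Polynomial.aeval (z 0) (antideriv A) : ℝ), ?_, ?_, ?_, fun _ _ => h32.le, rfl,
    ?_, ?_, ?_, rfl⟩
  · exact isSemialgebraicFunOn_aeval_apply_zero (isSemialgebraic_closedBandQ h32 h21 hf) _
  · exact isSemialgebraicFunOn_const_root he₃
  · exact isSemialgebraicFunOn_const_root he₂
  · intro x _
    show ContinuousOn (fun t : ℝ =>
      (Polynomial.aeval ((Fin.snoc x t : Fin 1 → ℝ) 0) (antideriv A) : ℝ)) _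
    simp only [snoc_apply_zero']
    exact (Polynomial.continuous_aeval _).continuousOn
  · intro x _ t _
    show HasDerivAt (fun s : ℝ =>
      (Polynomial.aeval ((Fin.snoc x s : Fin 1 → ℝ) 0) (antideriv A) : ℝ))
      ((polyBandRep h32 h21 hf A).integrand (Fin.snoc x t)) t
    simp only [snoc_apply_zero', polyBandRep]
    exact hasDerivAt_aeval_antideriv A t
  · intro x _
    show (0 : ℝ) = (Polynomial.aeval ((Fin.snoc x ((fun _ => e₂) x) : Fin 1 → ℝ) 0) (antideriv A) : ℝ)
      - Polynomial.aeval ((Fin.snoc x ((fun _ => e₃) x) : Fin 1 → ℝ) 0) (antideriv A)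
    simp only [snoc_apply_zero']
    exact hG.symm

/-- `[polyBandRep] ∈ relations` when `G(e₂) − G(e₃) = 0`. [folklore] -/
theorem of_polyBandRep_mem_relations (h32 : e₃ < e₂) (h21 : e₂ < e₁)
    (hf : ∀ x, cubic q₂ q₃ x = 4 * (x - e₃) * (x - e₂) * (x - e₁)) (A : ℚ[X])
    (hG : (Polynomial.aeval e₂ (antideriv A) : ℝ) - Polynomial.aeval e₃ (antideriv A) = 0) :
    KZ.of (polyBandRep h32 h21 hf A) ∈ relations := by
  have h1 := newtonLeibnizRel_subset_relations
    (of_polyBandRep_sub_mem_newtonLeibnizRel h32 h21 hf A hG)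
  simpa using relations.add_mem h1 of_zeroBaseRep_mem_relations

/-- `[polyEndsRep] ∈ relations` (null domain). [folklore] -/
theorem of_polyEndsRep_mem_relations
    (hf : ∀ x, cubic q₂ q₃ x = 4 * (x - e₃) * (x - e₂) * (x - e₁)) (A : ℚ[X]) :
    KZ.of (polyEndsRep hf A) ∈ relations :=
  of_mem_relations_of_volume_eq_zero _ (volume_endsQ e₃ e₂)

/-- **Part 2 of the stub**: closed band versus open `σ` is ONE domain-additivity move, so every
representation `[σ, A]` with `G(e₂) − G(e₃) = 0` is a relation. [folklore] -/
theorem of_mem_relations_of_poly (h32 : e₃ < e₂) (h21 : e₂ < e₁)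
    (hf : ∀ x, cubic q₂ q₃ x = 4 * (x - e₃) * (x - e₂) * (x - e₁)) (A : ℚ[X])
    (hG : (Polynomial.aeval e₂ (antideriv A) : ℝ) - Polynomial.aeval e₃ (antideriv A) = 0)
    (s : IntegralRep 1) (hs : s.domain = oval q₂ q₃)
    (hsi : EqOn s.integrand (fun p => (Polynomial.aeval (p 0) A : ℝ)) (oval q₂ q₃)) :
    KZ.of s ∈ KZ.relations := by
  have hadd : KZ.of (polyBandRep h32 h21 hf A) - KZ.of s - KZ.of (polyEndsRep hf A) ∈ domainAddRel := by
    refine ⟨1, polyBandRep h32 h21 hf A, s, polyEndsRep hf A, ?_, ?_, fun p hp => ?_,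
      fun _ _ => rfl, rfl⟩
    · show closedBandQ e₃ e₂ = s.domain ∪ endsQ e₃ e₂
      rw [hs]; exact closedBandQ_eq_union h32 h21 hf
    · show volume (s.domain ∩ endsQ e₃ e₂) = 0
      rw [hs, oval_inter_endsQ h32 h21 hf]; exact measure_empty
    · rw [hs] at hp
      exact (hsi hp).symm
  have h2 : KZ.of s = KZ.of (polyBandRep h32 h21 hf A) -
      (KZ.of (polyBandRep h32 h21 hf A) - KZ.of s - KZ.of (polyEndsRep hf A)) -
      KZ.of (polyEndsRep hf A) := by abel
  rw [h2]
  exact relations.sub_mem (relations.sub_mem (of_polyBandRep_mem_relations h32 h21 hf A hG)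
    (domainAddRel_subset_relations hadd)) (of_polyEndsRep_mem_relations hf A)

end PartTwo

/-- `stub_polynomialPart`, verbatim signature, sorry-free. -/
theorem stub_polynomialPart (q₂ q₃ : ℚ) (hΔ : 0 < disc q₂ q₃) (A : ℚ[X]) :
    IsAlgebraic ℚ (∫ p in oval q₂ q₃, (Polynomial.aeval (p 0) A : ℝ)) ∧
    ((∫ p in oval q₂ q₃, (Polynomial.aeval (p 0) A : ℝ)) = 0 →
      ∀ s : IntegralRep 1, s.domain = oval q₂ q₃ →
        EqOn s.integrand (fun p => (Polynomial.aeval (p 0) A : ℝ)) (oval q₂ q₃) →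
        KZ.of s ∈ KZ.relations) := by
  refine ⟨isAlgebraic_integral_aeval_oval hΔ A, fun h0 s hs hsi => ?_⟩
  obtain ⟨e₃, e₂, e₁, h3, h2a, h2b, h1, hf⟩ := exists_roots hΔ
  have h32 : e₃ < e₂ := by linarith
  have h21 : e₂ < e₁ := by linarith
  rw [integral_aeval_oval h32 h21 hf A] at h0
  exact of_mem_relations_of_poly h32 h21 hf A h0 s hs hsi

/-! # v4: `stub_hermiteExactForm` = support item `HermiteExactFormVanishes` (stmt-KontsevichZagierPeriods-3412) -/

section Hermite

open Summit.KontsevichZagierPeriods.KontsevichZagierPeriods.Theses.HermiteRigidity (HermiteExactFormVanishes)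

variable {e₃ e₂ e₁ : ℝ}

/-- The Hermite integrand `(P′f + P f′/2)/√f` as a function on `ℝ¹` (junk value `0` where `f ≤ 0`).
[folklore] -/
def hermiteIntegrand (q₂ q₃ : ℚ) (P : ℚ[X]) (p : Fin 1 → ℝ) : ℝ :=
  ((Polynomial.aeval (p 0) (Polynomial.derivative P) : ℝ) * cubic q₂ q₃ (p 0) +
    (Polynomial.aeval (p 0) P : ℝ) * (12 * (p 0) ^ 2 - (q₂ : ℝ)) / 2) / Real.sqrt (cubic q₂ q₃ (p 0))

/-- Its numerator as a `ℚ`-polynomial: `N = P′·f + P·(6X² − q₂/2)`. [folklore] -/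
def hermiteNumerator (q₂ q₃ : ℚ) (P : ℚ[X]) : ℚ[X] :=
  Polynomial.derivative P * (4 * Polynomial.X ^ 3 - Polynomial.C q₂ * Polynomial.X - Polynomial.C q₃) +
    P * (Polynomial.C (1 / 2 : ℚ) * (12 * Polynomial.X ^ 2 - Polynomial.C q₂))

/-- `hermiteIntegrand = N/√f` pointwise. [folklore] -/
theorem hermiteIntegrand_eq (q₂ q₃ : ℚ) (P : ℚ[X]) (p : Fin 1 → ℝ) :
    hermiteIntegrand q₂ q₃ P p =
      (Polynomial.aeval (p 0) (hermiteNumerator q₂ q₃ P) : ℝ) / Real.sqrt (cubic q₂ q₃ (p 0)) := by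
  simp only [hermiteIntegrand, hermiteNumerator, map_add, map_mul, map_sub, map_pow,
    Polynomial.aeval_X, Polynomial.aeval_C, eq_ratCast, map_ofNat, cubic]
  push_cast
  ring

/-- At a root of `f` the Hermite integrand takes the junk value `0`. [folklore] -/
theorem hermiteIntegrand_eq_zero_of_root (P : ℚ[X]) {p : Fin 1 → ℝ} (hp : cubic q₂ q₃ (p 0) = 0) :
    hermiteIntegrand q₂ q₃ P p = 0 := by
  simp [hermiteIntegrand, hp]

/-- The Hermite integrand is `ℚ`-semialgebraic on the open oval. [folklore] -/
theorem isSemialgebraicFunOn_hermiteIntegrand_oval (h : 0 < disc q₂ q₃) (P : ℚ[X]) :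
    IsSemialgebraicFunOn ℚ (oval q₂ q₃) (hermiteIntegrand q₂ q₃ P) :=
  (isSemialgebraicFunOn_carrier h 0 (hermiteNumerator q₂ q₃ P)).congr fun p _ => by
    rw [hermiteIntegrand_eq]; simp

/-- Integrability of the Hermite integrand on the oval. [folklore] -/
theorem integrableOn_hermiteIntegrand_oval (h : 0 < disc q₂ q₃) (P : ℚ[X]) :
    IntegrableOn (hermiteIntegrand q₂ q₃ P) (oval q₂ q₃) :=
  (integrableOn_aeval_div_sqrt_oval h (hermiteNumerator q₂ q₃ P)).congr_fun
    (fun p _ => (hermiteIntegrand_eq q₂ q₃ P p).symm) (isSemialgebraic_oval h).measurableSet_holds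

/-- The Hermite integrand vanishes on the ends, hence is semialgebraic there. [folklore] -/
theorem isSemialgebraicFunOn_hermiteIntegrand_ends
    (hf : ∀ x, cubic q₂ q₃ x = 4 * (x - e₃) * (x - e₂) * (x - e₁)) (P : ℚ[X]) :
    IsSemialgebraicFunOn ℚ (endsQ e₃ e₂) (hermiteIntegrand q₂ q₃ P) := by
  obtain ⟨he₃, he₂, -⟩ := cubic_roots_eq_zero hf
  refine (isSemialgebraicFunOn_aeval (isSemialgebraic_endsQ he₃ he₂)
    (0 : MvPolynomial (Fin 1) ℚ)).congr fun p hp => ?_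
  have : cubic q₂ q₃ (p 0) = 0 := by
    rcases hp with hp | hp <;> rw [hp] <;> assumption
  simp [hermiteIntegrand_eq_zero_of_root P this]

/-- The band representation `[[e₃,e₂], (P′f + Pf′/2)/√f]` — the `r` of the Hermite move. [folklore] -/
def hermiteBandRep (h32 : e₃ < e₂) (h21 : e₂ < e₁)
    (hf : ∀ x, cubic q₂ q₃ x = 4 * (x - e₃) * (x - e₂) * (x - e₁)) (P : ℚ[X]) : IntegralRep 1 where
  domain := closedBandQ e₃ e₂
  integrand := hermiteIntegrand q₂ q₃ P
  isSemialgebraic_domain := isSemialgebraic_closedBandQ h32 h21 hf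
  isSemialgebraicFunOn_integrand := by
    have hd : 0 < disc q₂ q₃ := disc_pos_of_oval_nonempty (by
      rw [oval_eq_of_roots h32 h21 hf]
      exact ⟨fun _ => (e₃ + e₂) / 2, by simp only [mem_setOf_eq, mem_Ioo]; constructor <;> linarith⟩)
    rw [closedBandQ_eq_union h32 h21 hf]
    exact IsSemialgebraicFunOn.union (isSemialgebraicFunOn_hermiteIntegrand_oval hd P)
      (isSemialgebraicFunOn_hermiteIntegrand_ends hf P) (fun _ _ => rfl) (fun _ _ => rfl)
  integrableOn := by
    have hd : 0 < disc q₂ q₃ := disc_pos_of_oval_nonempty (by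
      rw [oval_eq_of_roots h32 h21 hf]
      exact ⟨fun _ => (e₃ + e₂) / 2, by simp only [mem_setOf_eq, mem_Ioo]; constructor <;> linarith⟩)
    rw [closedBandQ_eq_union h32 h21 hf]
    refine (integrableOn_hermiteIntegrand_oval hd P).union ?_
    rw [IntegrableOn, Measure.restrict_eq_zero.2 (volume_endsQ e₃ e₂)]
    exact integrable_zero_measure

/-- The null representation on the ends with the Hermite integrand. [folklore] -/
def hermiteEndsRep (hf : ∀ x, cubic q₂ q₃ x = 4 * (x - e₃) * (x - e₂) * (x - e₁)) (P : ℚ[X]) :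
    IntegralRep 1 where
  domain := endsQ e₃ e₂
  integrand := hermiteIntegrand q₂ q₃ P
  isSemialgebraic_domain :=
    isSemialgebraic_endsQ (cubic_roots_eq_zero hf).1 (cubic_roots_eq_zero hf).2.1
  isSemialgebraicFunOn_integrand := isSemialgebraicFunOn_hermiteIntegrand_ends hf P
  integrableOn := by
    rw [IntegrableOn, Measure.restrict_eq_zero.2 (volume_endsQ e₃ e₂)]
    exact integrable_zero_measure

/-- The cubic has derivative `12x² − q₂`. [folklore] -/
theorem hasDerivAt_cubic_gen (q₂ q₃ : ℚ) (x : ℝ) :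
    HasDerivAt (cubic q₂ q₃) (12 * x ^ 2 - (q₂ : ℝ)) x := by
  have h3 : HasDerivAt (fun y : ℝ => y ^ 3) (3 * x ^ 2) x := by simpa using hasDerivAt_pow 3 x
  have h := ((h3.const_mul (4 : ℝ)).sub ((hasDerivAt_id x).const_mul (q₂ : ℝ))).sub_const (q₃ : ℝ)
  have hfun : cubic q₂ q₃ = fun y : ℝ => 4 * y ^ 3 - (q₂ : ℝ) * id y - (q₃ : ℝ) := by
    funext y; simp [cubic]
  have hval : (12 * x ^ 2 - (q₂ : ℝ)) = 4 * (3 * x ^ 2) - (q₂ : ℝ) * 1 := by ring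
  rw [hfun, hval]
  exact h

/-- The scalar identity behind `d(P√f) = (P′f + Pf′/2) dx/√f`. [folklore] -/
theorem hermite_alg {a b c f' s : ℝ} (hs : 0 < s) (hsq : s * s = c) :
    a * s + b * (f' / (2 * s)) = (a * c + b * f' / 2) / s := by
  rw [eq_div_iff hs.ne', ← hsq]
  field_simp

/-- `d/dt (P(t)√f(t)) = (P′f + Pf′/2)/√f` where `f t > 0`. [folklore] -/
theorem hasDerivAt_aeval_mul_sqrt (P : ℚ[X]) {t : ℝ} (ht : 0 < cubic q₂ q₃ t) :
    HasDerivAt (fun s : ℝ => (Polynomial.aeval s P : ℝ) * Real.sqrt (cubic q₂ q₃ s))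
      (hermiteIntegrand q₂ q₃ P (fun _ => t)) t := by
  have hP := P.hasDerivAt_aeval t
  have hs := (hasDerivAt_cubic_gen q₂ q₃ t).sqrt ht.ne'
  have hst : 0 < Real.sqrt (cubic q₂ q₃ t) := Real.sqrt_pos.2 ht
  have h2 : Real.sqrt (cubic q₂ q₃ t) * Real.sqrt (cubic q₂ q₃ t) = cubic q₂ q₃ t :=
    Real.mul_self_sqrt ht.le
  have key : (Polynomial.aeval t (Polynomial.derivative P) : ℝ) * Real.sqrt (cubic q₂ q₃ t) +
      (Polynomial.aeval t P : ℝ) * ((12 * t ^ 2 - (q₂ : ℝ)) / (2 * Real.sqrt (cubic q₂ q₃ t))) =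
      hermiteIntegrand q₂ q₃ P (fun _ => t) := by
    unfold hermiteIntegrand
    exact hermite_alg hst h2
  exact (hP.mul hs).congr_deriv key

/-- **The Hermite step is ONE legal Newton–Leibniz move**: `[hermiteBandRep] − [pt, 0] ∈
KZ.newtonLeibnizRel` (base `ℝ⁰`, bounds `a = e₃`, `b = e₂`, primitive `F = P√f`, continuous on
the CLOSED fibre, `HasDerivAt` the unbounded integrand on the OPEN fibre, `F(e₂) − F(e₃) = 0`).
[cite: KontsevichZagier2001, §1.2 rule (3)] [cite: BostanLairezSalvy2013, §1] -/
theorem of_hermiteBandRep_sub_mem_newtonLeibnizRel (h32 : e₃ < e₂) (h21 : e₂ < e₁)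
    (hf : ∀ x, cubic q₂ q₃ x = 4 * (x - e₃) * (x - e₂) * (x - e₁)) (P : ℚ[X]) :
    KZ.of (hermiteBandRep h32 h21 hf P) - KZ.of zeroBaseRep ∈ newtonLeibnizRel := by
  obtain ⟨he₃, he₂, -⟩ := cubic_roots_eq_zero hf
  obtain ⟨hpos, -⟩ := cubic_sign_of_roots h32 h21 hf
  refine ⟨0, hermiteBandRep h32 h21 hf P, zeroBaseRep, fun _ => e₃, fun _ => e₂,
    fun z => (Polynomial.aeval (z 0) P : ℝ) * Real.sqrt (cubic q₂ q₃ (z 0)),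
    ?_, ?_, ?_, fun _ _ => h32.le, rfl, ?_, ?_, ?_, rfl⟩
  · -- `F = P·√f` is semialgebraic on the band
    have hb := isSemialgebraic_closedBandQ h32 h21 hf
    have h1 := isSemialgebraicFunOn_aeval_apply_zero hb P
    have h2 : IsSemialgebraicFunOn ℚ (closedBandQ e₃ e₂)
        (fun z => Real.sqrt (MvPolynomial.aeval z (cubicPolyQ q₂ q₃))) :=
      IsSemialgebraicFunOn.sqrt_holds (isSemialgebraicFunOn_aeval hb (cubicPolyQ q₂ q₃))
    refine (IsSemialgebraicFunOn.mul_holds h1 h2).congr fun z _ => ?_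
    simp only [Pi.mul_apply, aeval_cubicPolyQ]
  · exact isSemialgebraicFunOn_const_root he₃
  · exact isSemialgebraicFunOn_const_root he₂
  · intro x _
    show ContinuousOn (fun t : ℝ => (Polynomial.aeval ((Fin.snoc x t : Fin 1 → ℝ) 0) P : ℝ) *
      Real.sqrt (cubic q₂ q₃ ((Fin.snoc x t : Fin 1 → ℝ) 0))) _
    simp only [snoc_apply_zero']
    exact ((Polynomial.continuous_aeval P).mul
      (Real.continuous_sqrt.comp continuous_cubic)).continuousOn
  · intro x _ t ht
    show HasDerivAt (fun s : ℝ => (Polynomial.aeval ((Fin.snoc x s : Fin 1 → ℝ) 0) P : ℝ) *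
      Real.sqrt (cubic q₂ q₃ ((Fin.snoc x s : Fin 1 → ℝ) 0)))
      ((hermiteBandRep h32 h21 hf P).integrand (Fin.snoc x t)) t
    simp only [snoc_apply_zero']
    have key := hasDerivAt_aeval_mul_sqrt P (hpos t ht)
    have hsame : (hermiteBandRep h32 h21 hf P).integrand (Fin.snoc x t) =
        hermiteIntegrand q₂ q₃ P (fun _ => t) := by
      show hermiteIntegrand q₂ q₃ P (Fin.snoc x t) = _
      simp only [hermiteIntegrand, snoc_apply_zero']
    rw [hsame]
    exact key
  · intro x _
    show (0 : ℝ) = (Polynomial.aeval ((Fin.snoc x ((fun _ => e₂) x) : Fin 1 → ℝ) 0) P : ℝ) *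
        Real.sqrt (cubic q₂ q₃ ((Fin.snoc x ((fun _ => e₂) x) : Fin 1 → ℝ) 0)) -
      (Polynomial.aeval ((Fin.snoc x ((fun _ => e₃) x) : Fin 1 → ℝ) 0) P : ℝ) *
        Real.sqrt (cubic q₂ q₃ ((Fin.snoc x ((fun _ => e₃) x) : Fin 1 → ℝ) 0))
    simp only [snoc_apply_zero', he₃, he₂, Real.sqrt_zero, mul_zero, sub_zero]

/-- `[hermiteBandRep] ∈ relations`. [folklore] -/
theorem of_hermiteBandRep_mem_relations (h32 : e₃ < e₂) (h21 : e₂ < e₁)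
    (hf : ∀ x, cubic q₂ q₃ x = 4 * (x - e₃) * (x - e₂) * (x - e₁)) (P : ℚ[X]) :
    KZ.of (hermiteBandRep h32 h21 hf P) ∈ relations := by
  have h1 := newtonLeibnizRel_subset_relations
    (of_hermiteBandRep_sub_mem_newtonLeibnizRel h32 h21 hf P)
  simpa using relations.add_mem h1 of_zeroBaseRep_mem_relations

/-- Closed band versus open `σ`: every `[σ, (P′f + Pf′/2)/√f]` is a relation. [folklore] -/
theorem of_mem_relations_of_hermite (h32 : e₃ < e₂) (h21 : e₂ < e₁)
    (hf : ∀ x, cubic q₂ q₃ x = 4 * (x - e₃) * (x - e₂) * (x - e₁)) (P : ℚ[X])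
    (r : IntegralRep 1) (hr : r.domain = oval q₂ q₃)
    (hri : EqOn r.integrand (hermiteIntegrand q₂ q₃ P) (oval q₂ q₃)) :
    KZ.of r ∈ KZ.relations := by
  have hadd : KZ.of (hermiteBandRep h32 h21 hf P) - KZ.of r - KZ.of (hermiteEndsRep hf P) ∈
      domainAddRel := by
    refine ⟨1, hermiteBandRep h32 h21 hf P, r, hermiteEndsRep hf P, ?_, ?_, fun p hp => ?_,
      fun _ _ => rfl, rfl⟩
    · show closedBandQ e₃ e₂ = r.domain ∪ endsQ e₃ e₂
      rw [hr]; exact closedBandQ_eq_union h32 h21 hf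
    · show volume (r.domain ∩ endsQ e₃ e₂) = 0
      rw [hr, oval_inter_endsQ h32 h21 hf]; exact measure_empty
    · rw [hr] at hp
      exact (hri hp).symm
  have h2 : KZ.of r = KZ.of (hermiteBandRep h32 h21 hf P) -
      (KZ.of (hermiteBandRep h32 h21 hf P) - KZ.of r - KZ.of (hermiteEndsRep hf P)) -
      KZ.of (hermiteEndsRep hf P) := by abel
  rw [h2]
  exact relations.sub_mem (relations.sub_mem (of_hermiteBandRep_mem_relations h32 h21 hf P)
    (domainAddRel_subset_relations hadd)) (of_mem_relations_of_volume_eq_zero _ (volume_endsQ e₃ e₂))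

end Hermite

/-- `stub_hermiteExactForm` = the route's support item `HermiteExactFormVanishes`
(stmt-KontsevichZagierPeriods-3412), VERBATIM, sorry-free. -/
theorem stub_hermiteExactForm :
    Summit.KontsevichZagierPeriods.KontsevichZagierPeriods.Theses.HermiteRigidity.HermiteExactFormVanishes := by
  intro q₂ q₃ hΔ P f σ r hr hri
  have hΔ' : 0 < disc q₂ q₃ := hΔ
  have hr' : r.domain = oval q₂ q₃ := hr
  have hri' : EqOn r.integrand (hermiteIntegrand q₂ q₃ P) (oval q₂ q₃) := hri
  obtain ⟨e₃, e₂, e₁, h3, h2a, h2b, h1, hf⟩ := exists_roots hΔ'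
  have h32 : e₃ < e₂ := by linarith
  have h21 : e₂ < e₁ := by linarith
  exact of_mem_relations_of_hermite h32 h21 hf P r hr' hri'

end Summit.KontsevichZagierPeriods.HermiteRigidity.EllipticMomentKernel.Drefute
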